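import Mathlib
import HarnessLib
import Summits.CriticalPhenomena.CardyFormulaZ2.Theses.CardySelfRefinement
import Literature.Probability.RandomPlanarGeometry.ChordalReversibility
import Literature.Probability.RandomPlanarGeometry.ConformalRectangle
import Literature.Probability.RandomPlanarGeometry.IsometryCovariance
import Literature.Probability.Percolation.IkhlefPonsaingFirstPassage
import Literature.Probability.Percolation.HalfPlaneOneArmQuasiMultiplicativity
import Literature.Probability.Percolation.HalfPlaneArmDiagonalInputs
import Literature.Probability.Percolation.LatticeSymmetry
import Summits.CriticalPhenomena.CardyFormulaZ2.Theorems.CardySelfRefinementSymmetryUpgradeRTouchDiagArmTwoSided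

/-!
# Two-scale diagonal half-plane arm of bond-`ℤ²` at `p = 1/2`: `P ≍ (r/R)^{1/3}`
# (conditional on Ikhlef–Ponsaing, Prop. 4.7)

Helper file for stub `stub_touchExponent` (S3) of line `SketchIdeatorTwo` of crux `SymmetryUpgradeR`
(stmt-CriticalPhenomena-17239, route CardySelfRefinement), stage T3.

Diagonal coordinates of `ℤ²`: `col v = v₀ - v₁`, `hgtOf v = v₀ + v₁` (`TrackExchange`); half-plane
`{hgtOf ≥ 0}` (a DIAGONAL wall of slope `-1` in lattice coordinates); half-plane norm seen from a
base point `b`, `ν_b(v) = max |col v - col b| (hgtOf v - hgtOf b)`; half-annulus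
`ann[b, r, R] = {0 ≤ hgtOf, r ≤ ν_b ≤ R}` and its crossing event
`E[b, r, R] = {ann[b, r, R] is crossed by an open path from {ν_b = r} to {ν_b = R}}` — the
half-plane one-arm event BETWEEN TWO SCALES (the block event of Nolin's quasi-multiplicativity,
`Literature/Probability/Percolation/HalfPlaneOneArmQuasiMultiplicativity.lean`, instantiated on the
diagonal inputs of `HalfPlaneArmDiagonalInputs.lean`).

Main result `touchExponent_twoScaleArm`: CONDITIONAL on the tree's named fact
`Literature.Probability.Percolation.IkhlefPonsaingFirstPassage` (Ikhlef–Ponsaing 2012, Prop. 4.7;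
unproved hypothesis, antecedent only) there are constants `0 < c`, `C` and a threshold `r₀ ≥ 1`
with

`c (r/R)^{1/3} ≤ P_{1/2}(E[b, r, R]) ≤ C (r/R)^{1/3}` for all base points `b` with
`0 ≤ hgtOf b ≤ 1` and all `r₀ ≤ r ≤ R`.

Proof. By T2 (`touchExponent_diagArmTwoSided`) and `real_diagArm_eq`, the one-arm probability
`A(n) = P(arm[(1,0), n])` satisfies `c₁ n^{-1/3} ≤ A(n) ≤ C₁ n^{-1/3}` (`n ≥ 1`). Upper half of
quasi-multiplicativity (`real_arm_le_mul`, independence of disjoint blocks):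
`A(R+1) ≤ A(r-2) · P(E[z₀, r, R])`, so `P(E) ≥ (c₁/C₁)((r-2)/(R+1))^{1/3} ≥ c (r/R)^{1/3}` for
`r ≥ 3`. Lower half (`real_arm_ge_mul`, Harris–FKG gluing through a U, RSW inputs `diag_rswLR`,
`diag_rswTB`): `c₀ A(2a) P(E[z₀, r, R]) ≤ A(R-1)` with `a = r + m₀ + 1` when `2a + 1 ≤ R`, so
`P(E) ≤ (C₁/(c₀c₁))(2a/(R-1))^{1/3} ≤ C (r/R)^{1/3}`; when `R ≤ 2a` the bound `C (r/R)^{1/3} ≥ 1`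
is trivial. Here `z₀ ∈ {(0,0), (1,0)}` is within one unit of the base `(1,0)`; a general base point
`b` of the boundary strip is reached by the lattice translation `v ↦ v + (-b₁, b₁)`, which
preserves `hgtOf` and `P_{1/2}` (`real_openCrossing_shift`).
-/

noncomputable section

namespace Summit.CriticalPhenomena.CardyFormulaZ2.Theorems.SymmetryUpgradeR.SwallowingSkeleton

open MeasureTheory Filter Set
open Literature.Probability.RandomPlanarGeometry Literature.Probability.LatticeModels
  Literature.Probability.Percolation
open UpperHalfPlane (upperHalfPlaneSet)
open Literature.Probability.Percolation.TrackExchange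

local notation3 "ν[" b ", " v "]" => max |col v - col b| (hgtOf v - hgtOf b)
local notation3 "ann[" b ", " r ", " R "]" =>
  {v : Site 2 | 0 ≤ hgtOf v ∧ r ≤ ν[b, v] ∧ ν[b, v] ≤ R}
local notation3 "E[" b ", " r ", " R "]" =>
  openCrossing ann[b, r, R] {v : Site 2 | ν[b, v] = r} {v : Site 2 | ν[b, v] = R}
local notation3 "armbox[" x ", " n "]" => {v : Site 2 | 0 ≤ hgtOf v ∧ ν[x, v] ≤ n}
local notation3 "arm[" x ", " n "]" => openCrossing armbox[x, n] {x} {v : Site 2 | ν[x, v] = n}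
local notation3 "μ" => bondPercolation (zdGraph 2) half

/-! ### The one-arm bounds in the abstract form -/

/-- T2 in the vocabulary of the abstract half-plane layer: two-sided `n^{-1/3}` bounds for the
diagonal arm based at `(1, 0)` (via `HalfPlaneArm.real_diagArm_eq`). -/
private theorem arm_twoSided (hIP : Literature.Probability.Percolation.IkhlefPonsaingFirstPassage) :
    ∃ c C : ℝ, 0 < c ∧ 0 < C ∧ ∀ n : ℕ, 1 ≤ n →
      c * (n : ℝ) ^ (-(1 / 3 : ℝ)) ≤ (μ).real arm[![1, 0], (n : ℤ)] ∧
        (μ).real arm[![1, 0], (n : ℤ)] ≤ C * (n : ℝ) ^ (-(1 / 3 : ℝ)) := by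
  obtain ⟨c, C, hc, h⟩ := touchExponent_diagArmTwoSided hIP
  have hC : 0 < C := by
    obtain ⟨h1, h2⟩ := h 1 le_rfl
    simp only [Nat.cast_one, Real.one_rpow, mul_one] at h1 h2
    linarith
  refine ⟨c, C, hc, hC, fun n hn => ?_⟩
  rw [← HalfPlaneArm.real_diagArm_eq n]
  exact h n hn

/-- `x^{-1/3} / y^{-1/3} = (y/x)^{1/3}` for positive `x, y`. -/
private theorem rpow_neg_div_rpow_neg {x y : ℝ} (hx : 0 < x) (hy : 0 < y) :
    x ^ (-(1 / 3 : ℝ)) / y ^ (-(1 / 3 : ℝ)) = (y / x) ^ (1 / 3 : ℝ) := by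
  rw [Real.rpow_neg hx.le, Real.rpow_neg hy.le, Real.div_rpow hy.le hx.le]
  field_simp

/-! ### Lower bound near the base point -/

/-- Lower bound `c (r/R)^{1/3} ≤ P(E[z₀, r, R])` for centres `z₀` within one unit of `(1, 0)` and
`3 ≤ r ≤ R` (upper half of quasi-multiplicativity + T2). -/
private theorem E_lower (hIP : Literature.Probability.Percolation.IkhlefPonsaingFirstPassage) :
    ∃ c : ℝ, 0 < c ∧ ∀ (z₀ : Site 2) (r R : ℕ), |col ![1, 0] - col z₀| ≤ 1 →
      |hgtOf ![1, 0] - hgtOf z₀| ≤ 1 → 3 ≤ r → r ≤ R →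
      c * ((r : ℝ) / R) ^ (1 / 3 : ℝ) ≤ (μ).real E[z₀, (r : ℤ), (R : ℤ)] := by
  obtain ⟨c, C, hc, hC, hA⟩ := arm_twoSided hIP
  refine ⟨c / C * (6 : ℝ) ^ (-(1 / 3 : ℝ)), by positivity, fun z₀ r R hX0 hY0 hr hrR => ?_⟩
  have key := HalfPlaneArm.real_arm_le_mul (X := col) (Y := hgtOf) HalfPlaneArm.diag_X_le
    HalfPlaneArm.diag_Y_le HalfPlaneArm.diag_injective half hX0 hY0 (r := (r : ℤ) - 2)
    (R := (R : ℤ) + 1) (by omega) (by omega)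
  simp only [sub_add_cancel, add_sub_cancel_right] at key
  have hr2 : (((r - 2 : ℕ) : ℤ)) = (r : ℤ) - 2 := by push_cast [Nat.cast_sub (by omega : 2 ≤ r)]; ring
  have hR1 : (((R + 1 : ℕ) : ℤ)) = (R : ℤ) + 1 := by push_cast; ring
  obtain ⟨hlo, -⟩ := hA (R + 1) (by omega)
  obtain ⟨hlo', hup'⟩ := hA (r - 2) (by omega)
  rw [hR1] at hlo
  rw [hr2] at hlo' hup'
  have hr2' : ((r - 2 : ℕ) : ℝ) = (r : ℝ) - 2 := by push_cast [Nat.cast_sub (by omega : 2 ≤ r)]; ring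
  have hR1' : ((R + 1 : ℕ) : ℝ) = (R : ℝ) + 1 := by push_cast; ring
  rw [hR1'] at hlo
  rw [hr2'] at hlo' hup'
  have hr3 : (3 : ℝ) ≤ r := by exact_mod_cast hr
  have hR3 : (r : ℝ) ≤ R := by exact_mod_cast hrR
  have hrpos : (0 : ℝ) < (r : ℝ) - 2 := by linarith
  have hRpos : (0 : ℝ) < (R : ℝ) + 1 := by linarith
  have hE0 : 0 ≤ (μ).real E[z₀, (r : ℤ), (R : ℤ)] := measureReal_nonneg
  -- `E ≥ A(R+1) / A(r-2)`
  have hE : c * ((R : ℝ) + 1) ^ (-(1 / 3 : ℝ)) / (C * ((r : ℝ) - 2) ^ (-(1 / 3 : ℝ))) ≤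
      (μ).real E[z₀, (r : ℤ), (R : ℤ)] := by
    rw [div_le_iff₀ (by positivity)]
    calc c * ((R : ℝ) + 1) ^ (-(1 / 3 : ℝ)) ≤ _ := hlo
      _ ≤ _ := key
      _ ≤ C * ((r : ℝ) - 2) ^ (-(1 / 3 : ℝ)) * (μ).real E[z₀, (r : ℤ), (R : ℤ)] := by gcongr
      _ = _ := mul_comm _ _
  refine le_trans ?_ hE
  have e : c * (((R : ℝ) + 1) ^ (-(1 / 3 : ℝ))) / (C * ((r : ℝ) - 2) ^ (-(1 / 3 : ℝ))) =
      c / C * ((((r : ℝ) - 2) / ((R : ℝ) + 1)) ^ (1 / 3 : ℝ)) := by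
    rw [← rpow_neg_div_rpow_neg hRpos hrpos]
    field_simp
  rw [e, mul_assoc]
  refine mul_le_mul_of_nonneg_left ?_ (by positivity)
  have hR0 : (0 : ℝ) < R := by linarith
  rw [Real.rpow_neg (by norm_num : (0 : ℝ) ≤ 6), ← Real.inv_rpow (by norm_num : (0 : ℝ) ≤ 6),
    ← Real.mul_rpow (by positivity) (by positivity)]
  refine Real.rpow_le_rpow (by positivity) ?_ (by norm_num)
  rw [inv_mul_eq_div, div_div, div_le_div_iff₀ (by positivity) hRpos]
  nlinarith [mul_nonneg (by linarith : (0 : ℝ) ≤ 5 * r - 15) hR0.le]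

/-! ### Upper bound near the base point -/

/-- Upper bound `P(E[z₀, r, R]) ≤ C (r/R)^{1/3}` for centres `z₀` within one unit of `(1, 0)` and
`1 ≤ r ≤ R` (lower half of quasi-multiplicativity — Harris–FKG gluing through a U, RSW — + T2). -/
private theorem E_upper (hIP : Literature.Probability.Percolation.IkhlefPonsaingFirstPassage) :
    ∃ C : ℝ, ∀ (z₀ : Site 2) (r R : ℕ), |col ![1, 0] - col z₀| ≤ 1 →
      |hgtOf ![1, 0] - hgtOf z₀| ≤ 1 → 1 ≤ r → r ≤ R →
      (μ).real E[z₀, (r : ℤ), (R : ℤ)] ≤ C * ((r : ℝ) / R) ^ (1 / 3 : ℝ) := by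
  obtain ⟨c, C, hc, hC, hA⟩ := arm_twoSided hIP
  obtain ⟨c₀, hc₀, m₀, hG⟩ := HalfPlaneArm.real_arm_ge_mul (X := col) (Y := hgtOf)
    HalfPlaneArm.diag_X_le HalfPlaneArm.diag_Y_le HalfPlaneArm.diag_injective
    (emb := gmEmbedding (fun _ => (0 : ℝ)) (fun _ => Real.pi / 2)) isIsoradial_dia isRhombicTiling_dia
    (κ := 1) one_pos HalfPlaneArm.diag_re HalfPlaneArm.diag_im half HalfPlaneArm.diag_rswLR
    HalfPlaneArm.diag_rswTB
  set K : ℝ := 4 * (m₀ : ℝ) + 8 with hK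
  have hK0 : 0 < K := by positivity
  refine ⟨(C / (c₀ * c) + 1) * K ^ (1 / 3 : ℝ), fun z₀ r R hX0 hY0 hr hrR => ?_⟩
  have hr1 : (1 : ℝ) ≤ r := by exact_mod_cast hr
  have hrR' : (r : ℝ) ≤ R := by exact_mod_cast hrR
  have hE0 : 0 ≤ (μ).real E[z₀, (r : ℤ), (R : ℤ)] := measureReal_nonneg
  have hE1 : (μ).real E[z₀, (r : ℤ), (R : ℤ)] ≤ 1 := measureReal_le_one
  -- the gluing scale
  set a : ℕ := r + m₀ + 1 with ha
  rcases le_or_gt (2 * a + 1) R with haR | haR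
  · -- main case: glue
    have hx1 : hgtOf ![1, 0] = 1 := by simp [hgtOf]
    have haZ : (a : ℤ) = r + m₀ + 1 := by rw [ha]; push_cast; ring
    have key := hG ![1, 0] z₀ (a : ℤ) (r : ℤ) (2 * (a : ℤ)) (R : ℤ) (by rw [hx1]; norm_num) hX0 hY0
      (by rw [haZ]; omega) (by rw [hx1, haZ]; omega) (by positivity)
      (by rw [haZ]; omega) le_rfl (by exact_mod_cast haR)
    have h2a : (((2 * a : ℕ) : ℤ)) = 2 * (a : ℤ) := by push_cast; ring
    have hR1 : (((R - 1 : ℕ) : ℤ)) = (R : ℤ) - 1 := by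
      push_cast [Nat.cast_sub (by omega : 1 ≤ R)]; ring
    obtain ⟨hlo, -⟩ := hA (2 * a) (by omega)
    obtain ⟨-, hup⟩ := hA (R - 1) (by omega)
    rw [h2a] at hlo
    rw [hR1] at hup
    have h2a' : ((2 * a : ℕ) : ℝ) = 2 * (a : ℝ) := by push_cast; ring
    have hR1' : ((R - 1 : ℕ) : ℝ) = (R : ℝ) - 1 := by
      push_cast [Nat.cast_sub (by omega : 1 ≤ R)]; ring
    rw [h2a'] at hlo
    rw [hR1'] at hup
    have haR' : 2 * (a : ℝ) + 1 ≤ R := by exact_mod_cast haR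
    have ha' : (a : ℝ) = r + m₀ + 1 := by rw [ha]; push_cast; ring
    have hapos : (0 : ℝ) < 2 * (a : ℝ) := by rw [ha']; positivity
    have hRpos : (0 : ℝ) < (R : ℝ) - 1 := by linarith
    -- `E ≤ A(R-1) / (c₀ A(2a))`
    have hE : (μ).real E[z₀, (r : ℤ), (R : ℤ)] ≤
        C * ((R : ℝ) - 1) ^ (-(1 / 3 : ℝ)) / (c₀ * (c * (2 * (a : ℝ)) ^ (-(1 / 3 : ℝ)))) := by
      rw [le_div_iff₀ (by positivity)]
      calc (μ).real E[z₀, (r : ℤ), (R : ℤ)] * (c₀ * (c * (2 * (a : ℝ)) ^ (-(1 / 3 : ℝ))))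
          = c₀ * (c * (2 * (a : ℝ)) ^ (-(1 / 3 : ℝ))) * (μ).real E[z₀, (r : ℤ), (R : ℤ)] := by ring
        _ ≤ c₀ * (μ).real arm[![1, 0], 2 * (a : ℤ)] * (μ).real E[z₀, (r : ℤ), (R : ℤ)] := by gcongr
        _ ≤ _ := key
        _ ≤ _ := hup
    refine hE.trans ?_
    have e1 : C * ((R : ℝ) - 1) ^ (-(1 / 3 : ℝ)) / (c₀ * (c * (2 * (a : ℝ)) ^ (-(1 / 3 : ℝ)))) =
        C / (c₀ * c) * ((2 * (a : ℝ)) / ((R : ℝ) - 1)) ^ (1 / 3 : ℝ) := by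
      rw [← rpow_neg_div_rpow_neg hRpos hapos]
      field_simp
    rw [e1]
    have hR0 : (0 : ℝ) < R := by linarith
    have e2 : ((2 * (a : ℝ)) / ((R : ℝ) - 1)) ^ (1 / 3 : ℝ) ≤
        K ^ (1 / 3 : ℝ) * ((r : ℝ) / R) ^ (1 / 3 : ℝ) := by
      rw [← Real.mul_rpow hK0.le (by positivity)]
      refine Real.rpow_le_rpow (by positivity) ?_ (by norm_num)
      rw [mul_div_assoc', div_le_div_iff₀ hRpos hR0, ha', hK]
      have h1 : 2 * ((r : ℝ) + m₀ + 1) ≤ (2 * m₀ + 4) * r := by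
        nlinarith [mul_nonneg (Nat.cast_nonneg m₀ : (0 : ℝ) ≤ m₀) (by linarith : (0 : ℝ) ≤ r - 1)]
      calc 2 * ((r : ℝ) + m₀ + 1) * R ≤ (2 * m₀ + 4) * r * R :=
            mul_le_mul_of_nonneg_right h1 hR0.le
        _ ≤ (2 * m₀ + 4) * r * (2 * ((R : ℝ) - 1)) := by
            refine mul_le_mul_of_nonneg_left (by linarith) (by positivity)
        _ = (4 * (m₀ : ℝ) + 8) * r * ((R : ℝ) - 1) := by ring
    calc C / (c₀ * c) * ((2 * (a : ℝ)) / ((R : ℝ) - 1)) ^ (1 / 3 : ℝ)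
        ≤ C / (c₀ * c) * (K ^ (1 / 3 : ℝ) * ((r : ℝ) / R) ^ (1 / 3 : ℝ)) := by gcongr
      _ ≤ (C / (c₀ * c) + 1) * (K ^ (1 / 3 : ℝ) * ((r : ℝ) / R) ^ (1 / 3 : ℝ)) := by
          gcongr; linarith
      _ = _ := by ring
  · -- trivial case: `R ≤ 2a`, the bound is at least one
    have hRle : (R : ℝ) ≤ K * r := by
      have : (R : ℝ) < 2 * ((r : ℝ) + m₀ + 1) + 1 := by
        have h : ((R : ℕ) : ℝ) < ((2 * a + 1 : ℕ) : ℝ) := by exact_mod_cast haR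
        rw [ha] at h; push_cast at h; linarith
      rw [hK]; nlinarith
    have hRpos : (0 : ℝ) < R := by linarith
    have h1 : 1 ≤ K ^ (1 / 3 : ℝ) * ((r : ℝ) / R) ^ (1 / 3 : ℝ) := by
      rw [← Real.mul_rpow hK0.le (by positivity)]
      refine Real.one_le_rpow ?_ (by norm_num)
      rw [mul_div_assoc', le_div_iff₀ hRpos, one_mul]
      exact hRle
    calc (μ).real E[z₀, (r : ℤ), (R : ℤ)] ≤ 1 := hE1
      _ ≤ 1 * (K ^ (1 / 3 : ℝ) * ((r : ℝ) / R) ^ (1 / 3 : ℝ)) := by rw [one_mul]; exact h1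
      _ ≤ (C / (c₀ * c) + 1) * (K ^ (1 / 3 : ℝ) * ((r : ℝ) / R) ^ (1 / 3 : ℝ)) := by
          gcongr; linarith [div_nonneg hC.le (mul_pos hc₀ hc).le]
      _ = _ := by ring

/-! ### Translation along the wall -/

/-- A lattice translation by `t` with `hgtOf t = 0` preserves the half-plane `{hgtOf ≥ 0}` and
`P_{1/2}`, and carries `E[z₀, r, R]` to `E[z₀ + t, r, R]`. -/
private theorem real_E_shift (t z₀ : Site 2) (ht : hgtOf t = 0) (r R : ℤ) :
    (μ).real E[z₀ + t, r, R] = (μ).real E[z₀, r, R] := by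
  have e1 : ∀ v : Site 2, hgtOf (v + -t) = hgtOf v := fun v => by
    simp only [hgtOf, Pi.add_apply, Pi.neg_apply] at ht ⊢; omega
  have e2 : ∀ v : Site 2, ν[z₀, v + -t] = ν[z₀ + t, v] := fun v => by
    have h1 : col (v + -t) - col z₀ = col v - col (z₀ + t) := by
      simp only [col, Pi.add_apply, Pi.neg_apply]; ring
    have h2 : hgtOf (v + -t) - hgtOf z₀ = hgtOf v - hgtOf (z₀ + t) := by
      simp only [hgtOf, Pi.add_apply, Pi.neg_apply]; ring
    rw [h1, h2]
  rw [← real_openCrossing_shift half t (ann[z₀, r, R]) {v : Site 2 | ν[z₀, v] = r}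
    {v : Site 2 | ν[z₀, v] = R}]
  simp only [Set.image_add_right]
  congr 2 <;> ext v <;> simp only [Set.mem_preimage, Set.mem_setOf_eq] <;> simp only [e2]
  simp only [e1]

/-! ### The registered helper -/

/-- **T3 `touchExponent_twoScaleArm`** (registered helper for `stub_touchExponent`). Conditional on
Ikhlef–Ponsaing's Prop. 4.7 (`IkhlefPonsaingFirstPassage`): the probability that bond percolation
on `ℤ²` at `p = 1/2` contains an open crossing of the diagonal half-annulus
`{0 ≤ hgtOf, r ≤ ν_b ≤ R}` (`ν_b = max |col - col b| (hgtOf - hgtOf b)`) from `{ν_b = r}` to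
`{ν_b = R}` — the DIAGONAL half-plane one-arm event between the scales `r` and `R` — is
`≍ (r/R)^{1/3}`: `c (r/R)^{1/3} ≤ P ≤ C (r/R)^{1/3}` for all base points `b` of the boundary strip
`0 ≤ hgtOf b ≤ 1` and all `r₀ ≤ r ≤ R`, with constants `0 < c`, `C`, `r₀ ≥ 1` independent of
`b, r, R`. -/
theorem touchExponent_twoScaleArm : Literature.Probability.Percolation.IkhlefPonsaingFirstPassage → ∃ c C : ℝ, 0 < c ∧ ∃ r₀ : ℕ, 1 ≤ r₀ ∧ ∀ (b : Site 2) (r R : ℕ), 0 ≤ TrackExchange.hgtOf b → TrackExchange.hgtOf b ≤ 1 → r₀ ≤ r → r ≤ R → c * ((r : ℝ) / R) ^ (1 / 3 : ℝ) ≤ (bondPercolation (zdGraph 2) half).real (openCrossing {v : Site 2 | 0 ≤ TrackExchange.hgtOf v ∧ (r : ℤ) ≤ max |TrackExchange.col v - TrackExchange.col b| (TrackExchange.hgtOf v - TrackExchange.hgtOf b) ∧ max |TrackExchange.col v - TrackExchange.col b| (TrackExchange.hgtOf v - TrackExchange.hgtOf b) ≤ (R : ℤ)} {v : Site 2 | max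 |TrackExchange.col v - TrackExchange.col b| (TrackExchange.hgtOf v - TrackExchange.hgtOf b) = (r : ℤ)} {v : Site 2 | max |TrackExchange.col v - TrackExchange.col b| (TrackExchange.hgtOf v - TrackExchange.hgtOf b) = (R : ℤ)}) ∧ (bondPercolation (zdGraph 2) half).real (openCrossing {v : Site 2 | 0 ≤ TrackExchange.hgtOf v ∧ (r : ℤ) ≤ max |TrackExchange.col v - TrackExchange.col b| (TrackExchange.hgtOf v - TrackExchange.hgtOf b) ∧ max |TrackExchange.col v - TrackExchange.col b| (TrackExchange.hgtOf v - TrackExchange.hgtOf b) ≤ (R : ℤ)} {v : Site 2 | max |TrackExchange.col v - TrackExchange.col b| (TrackExchange.hgtOf v - TrackExchange.hgtOf b) = (r : ℤ)} {v : Site 2 | max |TrackExchange.col v - TrackExchange.col b| (TrackExchange.hgtOf v - TrackExchange.hgtOf b) = (R : ℤ)}) ≤ C * ((r : ℝ) / R) ^ (1 / 3 : ℝ) := by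
  intro hIP
  obtain ⟨c, hc, hlo⟩ := E_lower hIP
  obtain ⟨C, hup⟩ := E_upper hIP
  refine ⟨c, C, hc, 3, by norm_num, fun b r R hb0 hb1 hr hrR => ?_⟩
  -- translate the base point to `z₀ = (hgtOf b, 0) ∈ {(0,0), (1,0)}`
  set t : Site 2 := ![-b 1, b 1] with ht
  have ht0 : hgtOf t = 0 := by simp [hgtOf, ht]
  have hb : b = (b - t) + t := (sub_add_cancel b t).symm
  have hc0 : col (b - t) = hgtOf b := by simp [col, hgtOf, ht]
  have hh0 : hgtOf (b - t) = hgtOf b := by simp [hgtOf, ht]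
  have hX0 : |col ![1, 0] - col (b - t)| ≤ 1 := by
    rw [hc0, abs_le]; simp [col]; constructor <;> omega
  have hY0 : |hgtOf ![1, 0] - hgtOf (b - t)| ≤ 1 := by
    rw [hh0, abs_le]; simp [hgtOf]; simp only [hgtOf] at hb0 hb1; constructor <;> omega
  show c * ((r : ℝ) / R) ^ (1 / 3 : ℝ) ≤ (μ).real E[b, (r : ℤ), (R : ℤ)] ∧
    (μ).real E[b, (r : ℤ), (R : ℤ)] ≤ C * ((r : ℝ) / R) ^ (1 / 3 : ℝ)
  rw [hb, real_E_shift t (b - t) ht0]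
  exact ⟨hlo (b - t) r R hX0 hY0 hr hrR, hup (b - t) r R hX0 hY0 (by omega) hrR⟩

end Summit.CriticalPhenomena.CardyFormulaZ2.Theorems.SymmetryUpgradeR.SwallowingSkeleton

end
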